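import Summits.BirchSwinnertonDyer.BirchSwinnertonDyer.Theorems.GenusKolyvaginAtTwoEquivariantChebotarevAtTwoGenericPair
import Summits.BirchSwinnertonDyer.BirchSwinnertonDyer.Theorems.GenusKolyvaginAtTwoEquivariantChebotarevAtTwoKummerInvariant
import Summits.BirchSwinnertonDyer.BirchSwinnertonDyer.Theorems.GenusKolyvaginAtTwoEquivariantChebotarevAtTwoHalvingQuartic
import Summits.BirchSwinnertonDyer.Rank1Residual.X5.TwoAdicImageCertificates
import Summits.BirchSwinnertonDyer.Rank1Residual.X5.TwoAdicInstancesToolkit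
import Literature.NumberTheory.EllipticCurves.TwoAdicImageSurjectivityModFourProofs
import Literature.NumberTheory.EllipticCurves.ComplexMultiplicationRationalJIntegralProofs
import Literature.NumberTheory.QuadraticFields.FundamentalDiscriminant
import Literature.NumberTheory.EllipticCurves.HeegnerPointsImaginaryQuadraticProofs

/-!
# Route `GenusKolyvaginAtTwo`, LINE 6: Q5 `EquivariantChebotarevAtTwo` (stmt-BirchSwinnertonDyer-24881)
# AS TYPED IS FALSE — UNCONDITIONAL REFUTATION (seat gk2-p2 g8)

`theorem not_EquivariantChebotarevAtTwo : ¬ EquivariantChebotarevAtTwo`.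

Q5 (McCallum 1991, Cor. 3.2 "at `p = 2`", a Čebotarev statement with prescribed local orders for
`τ`-stable independent families in `H¹(K, E[2^M])`) quantifies over ALL imaginary quadratic `K`; it
omits the parent crux's binder `¬ IsSquare (d_K · (−|Δ_E|))`, i.e. Kolyvagin's exclusion
`K ≠ ℚ(√Δ_E)`. At the discriminant field `ρ̄_{E,2}(Γ_K) = A₃`, `H¹(K, E[2])` is an `𝔽₄`-space on which
`c` acts semilinearly, and a `τ`-stable, `ℤ`-independent, `𝔽₄`-DEPENDENT family has an EMPTY set of
admissible primes (seat g6: `…/Negative/…FalseOfDiscFieldClassAtTwo`, p608405/p609364 — `¬Q5` modulo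
one *generic* class). This file supplies the witness, all in the kernel:

* THE CURVE `E = 433a1 : y² + xy = x³ + 1` (`[1, 0, 0, 0, 1]`): `Δ = −433 < 0` (prime), `c₄ = 1`, so
  globally minimal (`gcd(Δ, c₄) = 1`), `j = −1/433 ∉ ℤ` hence no CM (CM curves have integral `j`),
  `ρ_{E,2^∞}` onto `GL₂(ℤ₂)` by the Dokchitser–Dokchitser certificates `ℓ = 7, 5, 3, 3` (no
  `2`-torsion; `433`, `866` non-residues; `j ≠ −4t³(t+8)`) over the PROVED criterion
  (`DokchitserDokchitser2012_surjective_mod_two_four_eight_holds`, Rouse–Zureick-Brown lift);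
* THE FIELD `K = ℚ(√−433)`, `d_K = −1732`, `d_K · Δ_E = 866²` (exists as a `Type`:
  `Quadratic.exists_numberField_discr_eq`), `c` its conjugation;
* TWO CLASSES `u = κ_K(P₁)`, `v = κ_K(P₂)`, the Kummer classes over `K` of the rational points
  `P₁ = (0, 1)`, `P₂ = (−1, 0)` of the rank-`2` curve: `c`-invariant (`conjAct_kummerMapTorsion_some`),
  and `u ≠ 0`, `v ≠ 0`, `u ≠ v` because `P₁`, `P₂`, `P₁ + P₂ = (3, −7)` are not `2`-divisible in `E(K)`:
  their halving quartics `X⁴ − 8X − 1`, `X⁴ + 4X³ + X² − 8X + 3`, `X⁴ − 12X³ − 3X² − 8X − 13` are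
  irreducible over `ℚ` (certificates mod `3, 5, 3`), and `4 ∤ [K:ℚ] = 2`;
* then `GenusExact.equivariantChebotarevAtTwo_false_of_two_invariant` (p618040): the generic class
  `x = u + ωv`.

CLASSIFICATION: **refuted-misstated.** The witness exploits exactly the missing side condition
`K ≠ ℚ(√Δ_E)`; the minimal repair Q5′ = Q5 with the binder `¬ IsSquare ((NumberField.discr K : ℚ) * -|W.Δ|)`
inserted after `IsImaginaryQuadratic K` is PROVED (`GenusExact.equivariantChebotarevAtTwo_of_not_isSquare`,
p606279), and the witness misses it (`d_K · Δ_E` is a square here). BSD is not proved (or disproved)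
by any of this; the parent crux `KolyvaginExactAtTwo` carries the binder and is untouched.

References: [McCallumLMS1991] §3 Cor. 3.2; [GrossLMS1991] §9 (hypothesis `K ⊄ ℚ(E_p)`);
[Kolyvagin1989] Thm. B (exclusion `K ≠ ℚ(√−|Δ|)`); [DokchitserDokchitserMathZ2012] Theorem;
[CremonaAlgorithms1997] Table 1 (433a1); [SilvermanAEC2009] III.2.3 (d), VIII.2, App. C §11.
-/

set_option autoImplicit false
set_option linter.dupNamespace false

noncomputable section

open scoped Classical

namespace Summit.BirchSwinnertonDyer.BirchSwinnertonDyer.Theorems.GenusExact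

open WeierstrassCurve NumberField Field Polynomial
open Literature.NumberTheory.GaloisRepresentations Literature.NumberTheory.EllipticCurves
open Literature.NumberTheory Literature.NumberTheory.QuadraticFields
open Summit.BirchSwinnertonDyer.BirchSwinnertonDyer.Theses.GenusKolyvaginAtTwo
open Summit.BirchSwinnertonDyer.Rank1Residual.X5 Summit.BirchSwinnertonDyer.Rank1Residual.X5.O1

/-! ### §1 The curve `433a1 = [1, 0, 0, 0, 1]`: kernel-decided data -/

/-- `b₂, b₄, b₆, b₈` of `433a1`. [cite: CremonaAlgorithms1997, Table 1 (433a1)] -/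
theorem e433_b : (⟨1, 0, 0, 0, 1⟩ : WeierstrassCurve ℚ).b₂ = 1 ∧ (⟨1, 0, 0, 0, 1⟩ : WeierstrassCurve ℚ).b₄ = 0 ∧
    (⟨1, 0, 0, 0, 1⟩ : WeierstrassCurve ℚ).b₆ = 4 ∧ (⟨1, 0, 0, 0, 1⟩ : WeierstrassCurve ℚ).b₈ = 1 := by
  norm_num [WeierstrassCurve.b₂, WeierstrassCurve.b₄, WeierstrassCurve.b₆, WeierstrassCurve.b₈]

/-- `Δ(433a1) = −433`. [cite: CremonaAlgorithms1997, Table 1 (433a1)] -/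
theorem e433_Δ : (⟨1, 0, 0, 0, 1⟩ : WeierstrassCurve ℚ).Δ = -433 := by
  norm_num [WeierstrassCurve.Δ, WeierstrassCurve.b₂, WeierstrassCurve.b₄, WeierstrassCurve.b₆,
    WeierstrassCurve.b₈]

/-- `433a1` is an elliptic curve. [cite: CremonaAlgorithms1997, Table 1 (433a1)] -/
theorem isElliptic_e433 : (⟨1, 0, 0, 0, 1⟩ : WeierstrassCurve ℚ).IsElliptic :=
  ⟨by rw [isUnit_iff_ne_zero, e433_Δ]; norm_num⟩

/-- `j(433a1) = −1/433`. [cite: CremonaAlgorithms1997, Table 1 (433a1)] -/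
theorem e433_j : @WeierstrassCurve.j _ _ (⟨1, 0, 0, 0, 1⟩ : WeierstrassCurve ℚ) isElliptic_e433 =
    ((-1 : ℤ) : ℚ) / ((433 : ℤ) : ℚ) := by
  rw [WeierstrassCurve.j, Units.val_inv_eq_inv_val, WeierstrassCurve.coe_Δ']
  norm_num [WeierstrassCurve.c₄, WeierstrassCurve.Δ, WeierstrassCurve.b₂, WeierstrassCurve.b₄,
    WeierstrassCurve.b₆, WeierstrassCurve.b₈]

/-- Cremona's model `433a1` is globally minimal (`gcd(Δ, c₄) = gcd(−433, 1) = 1`).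
[cite: SilvermanAEC2009, VII.1 Remark 1.1] -/
theorem isGloballyMinimal_e433 : (⟨1, 0, 0, 0, 1⟩ : WeierstrassCurve ℚ).IsGloballyMinimal := by
  have h := Instances.isGloballyMinimal_of_gcd_eq_one 1 0 0 0 1 (by decide)
  simpa using h

/-- `433a1` has no complex multiplication: `j = −1/433` is not an integer, whereas CM curves over `ℚ`
have integral `j`. [cite: SilvermanAEC2009, App. C §11] -/
theorem not_hasCM_e433 : ¬ @WeierstrassCurve.HasCM _ _ (⟨1, 0, 0, 0, 1⟩ : WeierstrassCurve ℚ) := by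
  haveI := isElliptic_e433
  intro hCM
  obtain ⟨m, hm⟩ := exists_intCast_eq_j_of_hasCM _ hCM
  rw [e433_j] at hm
  have h' : (m : ℚ) * 433 = -1 := by rw [hm]; push_cast; field_simp
  have h'' : m * 433 = -1 := by exact_mod_cast h'
  omega

/-- **`ρ_{433a1, 2^n}` is onto for every `n`** (Dokchitser–Dokchitser certificates `ℓ = 7, 5, 3, 3` over
the proved criterion, then the mod-`8` lift). [cite: DokchitserDokchitserMathZ2012, Theorem (p. 961)]
[cite: RouseZureickbrown2015, §3 Lemma and §1] -/
theorem hasSurjectiveModNGaloisRep_two_pow_e433 (n : ℕ) :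
    @WeierstrassCurve.HasSurjectiveModNGaloisRep _ _ (⟨1, 0, 0, 0, 1⟩ : WeierstrassCurve ℚ) (2 ^ n : ℕ) := by
  haveI := isElliptic_e433
  have hT : TwoAdicSurjective (⟨1, 0, 0, 0, 1⟩ : WeierstrassCurve ℚ) := by
    refine twoAdicSurjective_of_certificates _ DokchitserDokchitser2012_surjective_mod_two_four_eight_holds
      (B₂ := 1) (B₄ := 0) (B₆ := 4) (D := -433) (n := -1) (d := 433)
      (ℓ₁ := 7) (ℓ₂ := 5) (ℓ₃ := 3) (ℓ₄ := 3) ?_ ?_ ?_ ?_ (by norm_num) e433_j (by norm_num) ?_ ?_ ?_ ?_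
    · norm_num [WeierstrassCurve.b₂]
    · norm_num [WeierstrassCurve.b₄]
    · norm_num [WeierstrassCurve.b₆]
    · rw [e433_Δ]; norm_num
    · decide
    · decide
    · decide
    · decide
  have h8 : (⟨1, 0, 0, 0, 1⟩ : WeierstrassCurve ℚ).HasSurjectiveModNGaloisRep 8 := by
    have := hT 3 (by norm_num)
    norm_num at this
    exact this
  have h := hasSurjectiveModNGaloisRep_two_pow_of_eight_holds _ h8 n
  have hc : ((2 ^ n : ℕ) : ℤ) = (2 : ℤ) ^ n := by push_cast; rfl
  rw [hc]
  exact h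

/-! ### §2 The three rational points and their halving quartics -/

/-- `P₁ = (0, 1)`, `P₂ = (−1, 0)` and `P₁ + P₂ = (3, −7)` lie on `433a1`. [cite: CremonaAlgorithms1997, Table 1 (433a1)] -/
theorem nonsingular_e433 :
    (⟨1, 0, 0, 0, 1⟩ : WeierstrassCurve ℚ).toAffine.Nonsingular 0 1 ∧
      (⟨1, 0, 0, 0, 1⟩ : WeierstrassCurve ℚ).toAffine.Nonsingular (-1) 0 ∧
      (⟨1, 0, 0, 0, 1⟩ : WeierstrassCurve ℚ).toAffine.Nonsingular 3 (-7) := by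
  haveI := isElliptic_e433
  refine ⟨?_, ?_, ?_⟩ <;>
  · rw [← WeierstrassCurve.Affine.equation_iff_nonsingular, WeierstrassCurve.Affine.equation_iff]
    norm_num

/-- The chord through `(0, 1)` and `(−1, 0)` on `433a1`: `(0,1) + (−1,0) = (3, −7)` (slope `1`).
[cite: SilvermanAEC2009, III.2.3 (group law algorithm)] -/
theorem addX_addY_e433 :
    (⟨1, 0, 0, 0, 1⟩ : WeierstrassCurve ℚ).toAffine.addX 0 (-1)
        ((⟨1, 0, 0, 0, 1⟩ : WeierstrassCurve ℚ).toAffine.slope 0 (-1) 1 0) = 3 ∧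
      (⟨1, 0, 0, 0, 1⟩ : WeierstrassCurve ℚ).toAffine.addY 0 (-1) 1
        ((⟨1, 0, 0, 0, 1⟩ : WeierstrassCurve ℚ).toAffine.slope 0 (-1) 1 0) = -7 := by
  rw [WeierstrassCurve.Affine.slope_of_X_ne (by norm_num)]
  norm_num [WeierstrassCurve.Affine.addX, WeierstrassCurve.Affine.addY,
    WeierstrassCurve.Affine.negAddY, WeierstrassCurve.Affine.negY]

/-- The halving quartics of `x = 0, −1, 3` on `433a1` are irreducible over `ℚ` (certificates modulo
`3`, `5`, `3`). [cite: SilvermanAEC2009, III.2.3 (d)] -/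
theorem irreducible_halvingQuartics_e433 :
    Irreducible (X ^ 4 + C ((0 : ℤ) : ℚ) * X ^ 3 + C ((0 : ℤ) : ℚ) * X ^ 2 + C ((-8 : ℤ) : ℚ) * X +
        C ((-1 : ℤ) : ℚ) : ℚ[X]) ∧
      Irreducible (X ^ 4 + C ((4 : ℤ) : ℚ) * X ^ 3 + C ((1 : ℤ) : ℚ) * X ^ 2 + C ((-8 : ℤ) : ℚ) * X +
        C ((3 : ℤ) : ℚ) : ℚ[X]) ∧
      Irreducible (X ^ 4 + C ((-12 : ℤ) : ℚ) * X ^ 3 + C ((-3 : ℤ) : ℚ) * X ^ 2 +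
        C ((-8 : ℤ) : ℚ) * X + C ((-13 : ℤ) : ℚ) : ℚ[X]) :=
  ⟨irreducible_quartic_rat_of_certificate 0 0 (-8) (-1) (p := 3) (by norm_num) (by decide) (by decide),
    irreducible_quartic_rat_of_certificate 4 1 (-8) 3 (p := 5) (by norm_num) (by decide) (by decide),
    irreducible_quartic_rat_of_certificate (-12) (-3) (-8) (-13) (p := 3) (by norm_num) (by decide)
      (by decide)⟩

/-! ### §3 The field `ℚ(√−433)` -/

/-- An imaginary quadratic field of discriminant `−1732 = 4 · (−433)` exists (as a `Type`), and
`d_K · (−|Δ_{433a1}|) = (−1732)(−433) = 866²`. [cite: Marcus1977, Ch. 2 Thm. 1] -/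
theorem exists_discField_e433 : ∃ (K : Type) (_ : Field K) (_ : NumberField K),
    IsImaginaryQuadratic K ∧ NumberField.discr K = -1732 := by
  have hD : ((-1732 : ℤ) % 4 = 1 ∧ Squarefree (-1732 : ℤ) ∧ (-1732 : ℤ) ≠ 1) ∨
      (4 ∣ (-1732 : ℤ) ∧ ((-1732 : ℤ) / 4 % 4 = 2 ∨ (-1732 : ℤ) / 4 % 4 = 3) ∧
        Squarefree ((-1732 : ℤ) / 4)) := by
    refine Or.inr ⟨by norm_num, by norm_num, ?_⟩
    have h433 : ((-1732 : ℤ) / 4) = -433 := by norm_num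
    rw [h433]
    exact Int.squarefree_natAbs.mp (Nat.prime_iff.mp (by norm_num)).squarefree
  obtain ⟨K, _, _, hK2, hd⟩ := Quadratic.exists_numberField_discr_eq hD
  exact ⟨K, _, _, isImaginaryQuadratic_iff_discr_neg.2 ⟨hK2, by rw [hd]; norm_num⟩, hd⟩

/-! ### §4 The refutation -/

set_option maxHeartbeats 800000 in
/-- **Q5 `EquivariantChebotarevAtTwo` (item stmt-BirchSwinnertonDyer-24881) as typed is FALSE.**
Witness: `E = 433a1` (`Δ = −433 < 0`, globally minimal, non-CM, `ρ_{E,2^∞}` onto), `K = ℚ(√−433)`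
(`d_K · (−|Δ|) = 866²` — the field the parent crux excludes), `c` = complex conjugation, and the two
distinct non-zero `c`-invariant Kummer classes `κ_K(0, 1)`, `κ_K(−1, 0) ∈ H¹(K, E[2])` (non-vanishing:
the halving quartics of `(0,1)`, `(−1,0)`, `(0,1)+(−1,0) = (3,−7)` are irreducible over `ℚ` and
`[K:ℚ] = 2`), fed to `equivariantChebotarevAtTwo_false_of_two_invariant`. refuted-MISSTATED: the
repaired statement with the parent's binder `¬ IsSquare ((NumberField.discr K : ℚ) * -|W.Δ|)` inserted
after `IsImaginaryQuadratic K` is PROVED (`equivariantChebotarevAtTwo_of_not_isSquare`, p606279) and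
this witness misses it. [cite: McCallumLMS1991, §3 Cor. 3.2 (hypothesis K ⊄ ℚ(E_p) of §3)]
[cite: GrossLMS1991, §9 (standing hypothesis K ⊄ ℚ(E_p))] [cite: DokchitserDokchitserMathZ2012, Theorem]
[cite: CremonaAlgorithms1997, Table 1 (433a1)] -/
theorem not_EquivariantChebotarevAtTwo : ¬ EquivariantChebotarevAtTwo := by
  -- the curve
  haveI hE := isElliptic_e433
  haveI hM := isGloballyMinimal_e433
  have hΔ : (⟨1, 0, 0, 0, 1⟩ : WeierstrassCurve ℚ).Δ < 0 := by rw [e433_Δ]; norm_num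
  -- the field and its conjugation
  obtain ⟨K, _, _, hK, hdK⟩ := exists_discField_e433
  have hsq : IsSquare ((NumberField.discr K : ℚ) * -|(⟨1, 0, 0, 0, 1⟩ : WeierstrassCurve ℚ).Δ|) := by
    rw [hdK, e433_Δ]
    exact ⟨866, by norm_num⟩
  obtain ⟨c, hc⟩ : ∃ c : K ≃ₐ[ℚ] K, c ≠ 1 := by
    haveI : Algebra.IsQuadraticExtension ℚ K := ⟨hK.1⟩
    have hcard : Nat.card (K ≃ₐ[ℚ] K) = 2 := by rw [IsGalois.card_aut_eq_finrank, hK.1]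
    obtain ⟨y, hy, -⟩ := (Nat.card_eq_two_iff' (1 : K ≃ₐ[ℚ] K)).mp hcard
    exact ⟨y, hy⟩
  haveI : PerfectField K := PerfectField.ofCharZero
  haveI : ((⟨1, 0, 0, 0, 1⟩ : WeierstrassCurve ℚ).baseChange K).IsElliptic := by
    rw [WeierstrassCurve.baseChange]; infer_instance
  -- the three rational points, read in `E(K)`
  have hinj := (algebraMap ℚ K).injective
  obtain ⟨h1Q, h2Q, h3Q⟩ := nonsingular_e433
  have hP1 : ((⟨1, 0, 0, 0, 1⟩ : WeierstrassCurve ℚ).baseChange K).toAffine.Nonsingular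
      (algebraMap ℚ K 0) (algebraMap ℚ K 1) :=
    (WeierstrassCurve.Affine.map_nonsingular _ hinj _ _).mpr h1Q
  have hP2 : ((⟨1, 0, 0, 0, 1⟩ : WeierstrassCurve ℚ).baseChange K).toAffine.Nonsingular
      (algebraMap ℚ K (-1)) (algebraMap ℚ K 0) :=
    (WeierstrassCurve.Affine.map_nonsingular _ hinj _ _).mpr h2Q
  have hP3 : ((⟨1, 0, 0, 0, 1⟩ : WeierstrassCurve ℚ).baseChange K).toAffine.Nonsingular
      (algebraMap ℚ K 3) (algebraMap ℚ K (-7)) :=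
    (WeierstrassCurve.Affine.map_nonsingular _ hinj _ _).mpr h3Q
  -- `P₁ + P₂ = P₃` in `E(K)` (chord of slope `1`)
  have hsum : (WeierstrassCurve.Affine.Point.some _ _ hP1) + (.some _ _ hP2) = .some _ _ hP3 := by
    have hx : algebraMap ℚ K 0 ≠ algebraMap ℚ K (-1) := fun h ↦ by
      have := hinj h; norm_num at this
    rw [WeierstrassCurve.Affine.Point.add_of_X_ne hx]
    obtain ⟨hX, hY⟩ := addX_addY_e433
    refine WeierstrassCurve.Affine.Point.some_eq_some_of_eq ?_ ?_
    · rw [WeierstrassCurve.baseChange, WeierstrassCurve.Affine.map_slope,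
        WeierstrassCurve.Affine.map_addX, hX]
    · rw [WeierstrassCurve.baseChange, WeierstrassCurve.Affine.map_slope,
        WeierstrassCurve.Affine.map_addY, hY]
  -- no halves over `K`
  obtain ⟨hb₂, hb₄, hb₆, hb₈⟩ := e433_b
  obtain ⟨hq1, hq2, hq3⟩ := irreducible_halvingQuartics_e433
  have hn1 := not_exists_add_self_eq_of_irreducible _ K hK.1 hP1 (c₃ := 0) (c₂ := 0) (c₁ := -8)
    (c₀ := -1) (by norm_num) (by rw [hb₄, hb₂]; norm_num) (by rw [hb₆, hb₄]; norm_num)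
    (by rw [hb₈, hb₆]; norm_num) hq1
  have hn2 := not_exists_add_self_eq_of_irreducible _ K hK.1 hP2 (c₃ := 4) (c₂ := 1) (c₁ := -8)
    (c₀ := 3) (by norm_num) (by rw [hb₄, hb₂]; norm_num) (by rw [hb₆, hb₄]; norm_num)
    (by rw [hb₈, hb₆]; norm_num) hq2
  have hn3 := not_exists_add_self_eq_of_irreducible _ K hK.1 hP3 (c₃ := -12) (c₂ := -3) (c₁ := -8)
    (c₀ := -13) (by norm_num) (by rw [hb₄, hb₂]; norm_num) (by rw [hb₆, hb₄]; norm_num)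
    (by rw [hb₈, hb₆]; norm_num) hq3
  -- the Kummer classes `u = κ_K(P₁)`, `v = κ_K(P₂)` at level `2 = 2^1`
  have hdiv : ∀ P : geomPoints ((⟨1, 0, 0, 0, 1⟩ : WeierstrassCurve ℚ).baseChange K),
      ∃ Q : geomPoints ((⟨1, 0, 0, 0, 1⟩ : WeierstrassCurve ℚ).baseChange K),
        ((2 ^ 1 : ℕ) : ℤ) • Q = P := fun P ↦
    ((⟨1, 0, 0, 0, 1⟩ : WeierstrassCurve ℚ).baseChange K).zsmul_geomPoints_surjective_of_charZero
      (by norm_num) P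
  have h2R : ∀ R : ((⟨1, 0, 0, 0, 1⟩ : WeierstrassCurve ℚ).baseChange K).toAffine.Point,
      ((2 ^ 1 : ℕ) : ℤ) • R = R + R := fun R ↦ by
    rw [show ((2 ^ 1 : ℕ) : ℤ) = 2 by norm_num, two_zsmul]
  have hne1 : ¬ ∃ R : ((⟨1, 0, 0, 0, 1⟩ : WeierstrassCurve ℚ).baseChange K).toAffine.Point,
      ((2 ^ 1 : ℕ) : ℤ) • R = .some _ _ hP1 := by
    rintro ⟨R, hR⟩; exact hn1 ⟨R, by rw [← h2R, hR]⟩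
  have hne2 : ¬ ∃ R : ((⟨1, 0, 0, 0, 1⟩ : WeierstrassCurve ℚ).baseChange K).toAffine.Point,
      ((2 ^ 1 : ℕ) : ℤ) • R = .some _ _ hP2 := by
    rintro ⟨R, hR⟩; exact hn2 ⟨R, by rw [← h2R, hR]⟩
  have hne3 : ¬ ∃ R : ((⟨1, 0, 0, 0, 1⟩ : WeierstrassCurve ℚ).baseChange K).toAffine.Point,
      (2 : ℤ) • R = .some _ _ hP1 + .some _ _ hP2 := by
    rintro ⟨R, hR⟩; exact hn3 ⟨R, by rw [← two_zsmul, hR, hsum]⟩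
  set u := ((⟨1, 0, 0, 0, 1⟩ : WeierstrassCurve ℚ).baseChange K).kummerMapTorsion ((2 ^ 1 : ℕ) : ℤ)
    hdiv (.some _ _ hP1) with hu
  set v := ((⟨1, 0, 0, 0, 1⟩ : WeierstrassCurve ℚ).baseChange K).kummerMapTorsion ((2 ^ 1 : ℕ) : ℤ)
    hdiv (.some _ _ hP2) with hv
  have hcu : conjAct (⟨1, 0, 0, 0, 1⟩ : WeierstrassCurve ℚ) c ((2 ^ 1 : ℕ) : ℤ) u = u :=
    conjAct_kummerMapTorsion_some _ _ hdiv c hP1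
  have hcv : conjAct (⟨1, 0, 0, 0, 1⟩ : WeierstrassCurve ℚ) c ((2 ^ 1 : ℕ) : ℤ) v = v :=
    conjAct_kummerMapTorsion_some _ _ hdiv c hP2
  have hu0 : u ≠ 0 := kummerMapTorsion_ne_zero_of_not_exists hdiv hne1
  have hv0 : v ≠ 0 := kummerMapTorsion_ne_zero_of_not_exists hdiv hne2
  have huv : u ≠ v := kummerMapTorsion_ne_of_not_exists hdiv hne3
  exact equivariantChebotarevAtTwo_false_of_two_invariant (⟨1, 0, 0, 0, 1⟩ : WeierstrassCurve ℚ)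
    not_hasCM_e433 hΔ K hK hsq hasSurjectiveModNGaloisRep_two_pow_e433 c hc u v hcu hcv hu0 hv0 huv

end Summit.BirchSwinnertonDyer.BirchSwinnertonDyer.Theorems.GenusExact

end
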